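import Summits.QuantumFields.YangMills.Theorems.BalabanUVNodesN06CutLettersPinsGradedAtRecord
import Literature.MathematicalPhysics.QuantumFieldTheory.Balaban1983to89.B9RWSums347DefiniteFaces
import Literature.MathematicalPhysics.QuantumFieldTheory.Balaban1983to89.B9RowSum261DefiniteFaces

/-!
# BalabanUVNodes ∕ N06 ([B9], `Dag.B9_main`) — ROWS 20–21's RE-CUT PROBE LETTER `hWE` (Φ^X_β∘∇_U∘G′∘R∘∇*_U : `bXH x U → 𝔠_{P_X}^{(β−1)}`) DERIVED ABOVE A CLOSED
# THRESHOLD **AT A DISPLAYED BUDGET FAMILY `Bx`** — v1.1 of `N06WELegAtPinsPhysRU` for the closed (3.49) constant of `N06Proj349AtPinsPhysRC`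

Track A of `YM-PLAN.md` (cell `pub-ymgap`, HUMAN RULING D-0062), node **N06** = [Balaban1985BackgroundPropagators] Thms 3.1–3.15; seat `pub-ymgap-dag-n06-d`
(gen 15).  WHY.  v1 (`N06WELegAtPinsPhysRU.hWE_of_pins_geo9Y`, p679199) returned `∃ MW BWE, …` because its constant
`BWE β = (c_R)⁻¹·((wX (sch β))⁻¹·B45 β + Bh β·(CP·L)·((wX (sch β))⁻¹·(L·e^{(δFW − αW δFW − σW)(r_near+1)}))·cσ·cσ)` contains the (3.49) constant `CP`, which edition 25's
`proj349Maj_of_t37_display348_rateR` only gave ∃-bound — so edition 57 ran the rows-20–21 leaf at `max (Bx13 β) (BWE β)`.  With `N06Proj349AtPinsPhysRC` (this seat, v1.1 of the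
(3.49) producer: `Proj349Maj … CP θ` for EVERY displayed `CP ≥ C_P⁽³·⁴⁹⁾`, the closed constant) the letter `CP` is DISPLAYED, hence the whole left side above is closed in
displayed data (`L = ℓ+1`, `cσ = rowConst261 geo9Y σW` = dag-n06-i's NAMED (2.61) constant), and dag-n06-l's `hWE_of_pins` can be fed its budget hypothesis `hBx` AS A
DISPLAYED NUMERIC FAMILY: ★★ `hWE_of_pins_geo9Y_budget : … → (hBx : ∀ β ∈ [0,1), (c_R)⁻¹·(…CP…) ≤ Bx β) → ∃ MW, ∀ x, MW ≤ M → … → ∀ β, hWE-shape at Bx β, rate δ₃`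
(member facts discharged exactly as in v1: `facts347_exp261_geo9Y`, `rowConst261_spec_of_rowSum261 rowSum261_geo9Y`).  The next edition displays `hBxW` at `Bx := Bx13`
and retires the `max` device.
HONEST FRAMING.  Kernel bookkeeping (∃-packaging of a landed member-∀ theorem with landed member-fact theorems); the (3.45)∕(3.43)₁ members and the (3.49) majorant are
HYPOTHESES; nothing of [B9] asserted; COUNT-NEUTRAL; N06 NOT discharged; K1⁹ NOT closed; one finite 𝕋⁴ programme at fixed `ε` — NOT continuum ∕ OS ∕ mass gap ∕ Clay.
0 `def`, 0 `sorry`.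
-/

noncomputable section

namespace Summit.QuantumFields.YangMills.BalabanUVNodes.N06WELegAtPinsPhysRUB

open Literature.MathematicalPhysics.QuantumFieldTheory.Balaban1983to89
open Literature.MathematicalPhysics.QuantumFieldTheory.Balaban1983to89.Node00 (FBondY IBondY SiteY CfgY SiteParY SiteOpY BondParY parSymY parBY GpY GpPhysY)
open Literature.MathematicalPhysics.QuantumFieldTheory.Balaban1983to89.Node00.OpsYSectDCoords (DvcoKH DvscoKH RcoK cR39_trBasis_pos)
open Literature.MathematicalPhysics.QuantumFieldTheory.Balaban1983to89.B9Thm39ReadingCoords (cR39)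
open Literature.MathematicalPhysics.QuantumFieldTheory.Balaban1983to89.B9Thm34Ext (toB6)
open Literature.MathematicalPhysics.QuantumFieldTheory.Balaban1983to89.B11SectG (HasMaj BlockNorm RowSum)
open Literature.MathematicalPhysics.QuantumFieldTheory.Balaban1983to89.B9Thm312Whole (cNorm GeoOK)
open Literature.MathematicalPhysics.QuantumFieldTheory.Balaban1983to89.B9Thm312WholeClasses (cNormR)
open Literature.MathematicalPhysics.QuantumFieldTheory.Balaban1983to89.B9RWSums343Holder (HolderProbes)
open Literature.MathematicalPhysics.QuantumFieldTheory.Balaban1983to89.B9RWSums343to347Whole (Facts347)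
open Literature.MathematicalPhysics.QuantumFieldTheory.Balaban1983to89.B9CoReadingCoords (XBK blkBK)
open Literature.MathematicalPhysics.QuantumFieldTheory.Balaban1983to89.B9CoReadingCoordsS (XSK sIK blkSK GcoS)
open Literature.MathematicalPhysics.QuantumFieldTheory.Balaban1983to89.B9CoReadingCoordsH (XHK)
open Literature.MathematicalPhysics.QuantumFieldTheory.Balaban1983to89.B9CoReadingCoordsHolder (PK)
open Literature.MathematicalPhysics.QuantumFieldTheory.Balaban1983to89.B9CoReadingCoordsTranspose (TrIdx trBasis)
open Literature.MathematicalPhysics.QuantumFieldTheory.Balaban1983to89.B9PinMembersKLevelV1 (MemberY geo9Y)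
open Literature.MathematicalPhysics.QuantumFieldTheory.Balaban1983to89.B9BackgroundsKLevelV1R (RegFamY bg9YR MemOfFam)
open Literature.MathematicalPhysics.QuantumFieldTheory.Balaban1983to89.B9GeoLemma21KLevelV1 (geo9Y_len_pos geo9Y_dist_triangle geo9Y_dist_comm)
open Literature.MathematicalPhysics.QuantumFieldTheory.Balaban1983to89.B9GeoNormsKLevelV1 (geo9K geo9K_dist_nonneg)
open Literature.MathematicalPhysics.QuantumFieldTheory.Balaban1983to89.B7Prop2SpecialUnitary (specialUnitaryUnits)
open Literature.MathematicalPhysics.QuantumFieldTheory.Balaban1983to89.B9PerturbationMajorantAlgebra (Proj349Maj)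
open Literature.MathematicalPhysics.QuantumFieldTheory.Balaban1983to89.B9PerturbationMajorantsAtLetters (PcoK rcoK_eq)
open Literature.MathematicalPhysics.QuantumFieldTheory.Balaban1983to89.B9PerturbationMajorantsAtLettersPhys (rcoK_GpPhysY)
open Literature.MathematicalPhysics.QuantumFieldTheory.Balaban1983to89.B9MultiscaleSmoothPartitionYNear (rNear)
open Literature.MathematicalPhysics.QuantumFieldTheory.Balaban1983to89.B9SmoothHolderClassT (bHZKT)
open Literature.MathematicalPhysics.QuantumFieldTheory.Balaban1983to89.B9SmoothHolderClassGraded (bHZKG)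
open Literature.MathematicalPhysics.QuantumFieldTheory.Balaban1983to89.B9GradViaDivLettersTransported (taxiB)
open Literature.MathematicalPhysics.QuantumFieldTheory.Balaban1983to89.B9Thm313WholeCutLettersAtPinsT (pWE_bHZKG_of_pins letters313Zc_bHZKG_of_pins)
open Literature.MathematicalPhysics.QuantumFieldTheory.Balaban1983to89.B6RandomWalkHom (HasMajorantHom)
open Literature.MathematicalPhysics.QuantumFieldTheory.Balaban1983to89.B9Thm313WholeZ (Letters313Z)
open Literature.MathematicalPhysics.QuantumFieldTheory.Balaban1983to89.B9Thm313WholeLettersCut (Letters313Zc)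
open Literature.MathematicalPhysics.QuantumFieldTheory.Balaban1983to89.B9PerturbationMajorantAlgebra (Thm31GpMaj)
open Literature.MathematicalPhysics.QuantumFieldTheory.Balaban1983to89.B9Thm312Whole (Identities)
open Literature.MathematicalPhysics.QuantumFieldTheory.Balaban1983to89.B9CoReadingCoordsHolder (blkPK probeK wK w₀K)
open Literature.MathematicalPhysics.QuantumFieldTheory.Balaban1983to89.B9CoReadingCoordsHolderAdm (wKA holderProbesKA)
open Literature.MathematicalPhysics.QuantumFieldTheory.Balaban1983to89.B9LettersHZAtOne (plateau_pos)
open B6GlobalChartV1 (PV blkV1) open B6Ineq2142KLevelV1 (β lvl) open B6Geom246MultiLevelTorus (geomT)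
open scoped Matrix.Norms.L2Operator

open Literature.MathematicalPhysics.QuantumFieldTheory.Balaban1983to89.B9RWSums347DefiniteFaces (exp261 facts347_exp261_geo9Y)
open Literature.MathematicalPhysics.QuantumFieldTheory.Balaban1983to89.B9RowSum261DefiniteFaces (rowConst261 rowConst261_nonneg rowConst261_spec_of_rowSum261)
open Literature.MathematicalPhysics.QuantumFieldTheory.Balaban1983to89.B9GeoLemma21KLevelV1 (rowSum261_geo9Y)
open Summit.QuantumFields.YangMills.BalabanUVNodes.N06CutLettersPinsGradedAtRecord (hWE_of_pins)

variable {N : ℕ} {d ℓ : ℕ} {hd : 1 ≤ d + 1} {hL : Odd (ℓ + 1) ∧ 1 < ℓ + 1} {b₀ b₁ : ℝ} {Mstar : ℕ}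

/-- ★★ **`hWE` DERIVED ABOVE A CLOSED THRESHOLD AT THE DISPLAYED BUDGET FAMILY `Bx`** (module docstring): for displayed rate letters `0 < αW < 1`, `0 < σW`,
`0 < δFW ≤ δP` with `0 ≤ δFW − αW·δFW − 2σW` dominating the target rate `δ₃` and dominated by the member rates `δ45 ∕ δh`, and a budget family
`hBx : (c_R)⁻¹·((wX (sch β))⁻¹·B45 β + Bh β·(CP·(ℓ+1))·((wX (sch β))⁻¹·((ℓ+1)·e^{(δFW − αW δFW − σW)(r_near+1)}))·cσ·cσ) ≤ Bx β` (`cσ := rowConst261 geo9Y σW`), there is a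
threshold `MW` with the certificate's `hWE` at constant `Bx β`, rate `δ₃`, for every member above `MW` — dag-n06-l's `hWE_of_pins` with `Facts347 ∕ RowSum` discharged at the
geometry of record. [cite: Balaban1985BackgroundPropagators, Thm 3.13 p.426 + (3.152)–(3.153) p.426 + (3.43)–(3.45) p.398 + (3.49) p.399 + (3.25) p.394 + p.398 (remark after (3.47)); Balaban1984PropagatorsII, (2.51)–(2.56) pp.232–233 + Lemma 2.1 (2.59)–(2.61) pp.233–234] -/
theorem hWE_of_pins_geo9Y_budget [NeZero N] [∀ x : MemberY d ℓ hd hL b₀ b₁ Mstar, Fintype (geo9Y x).Site]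
    {R₁ R₂ : RegFamY d ℓ hd hL b₀ b₁ Mstar (Matrix (Fin N) (Fin N) ℂ)} (H : MemberY d ℓ hd hL b₀ b₁ Mstar → Prop)
    (bI : ∀ x : MemberY d ℓ hd hL b₀ b₁ Mstar, FBondY x.toKIdx → IBondY x.toKIdx)
    (hlev : ∀ (x : MemberY d ℓ hd hL b₀ b₁ Mstar) (f : FBondY x.toKIdx), lvl x.hN x.D x.hk (bI x f) = (blkV1 x.hN x.D f).1.1)
    (hβ1 : ∀ (x : MemberY d ℓ hd hL b₀ b₁ Mstar) (f : FBondY x.toKIdx), (geomT x.D).dist (β x.hN x.D x.hk (bI x f)) (blkV1 x.hN x.D f) ≤ 1)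
    (hbI0 : ∀ (x : MemberY d ℓ hd hL b₀ b₁ Mstar) (f : FBondY x.toKIdx), bI x f = bI x ⟨f.src, 0⟩)
    (c : ℝ) {M₀ a₀ : ℝ} {αW σW δFW : ℝ} (hαW0 : 0 < αW) (hαW1 : αW < 1) (hσW : 0 < σW) (hδFW : 0 < δFW)
    (wX : ℝ → ℝ) (hwX₀ : ∀ s, 0 ≤ wX s) (hwX₁ : ∀ s, wX s ≤ 1) (sch : ℝ → ℝ) (hsch0 : ∀ β', 0 ≤ β' → β' < 1 → 0 < sch β') (hsch1 : ∀ β', 0 ≤ β' → β' < 1 → sch β' < 1)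
    (hwsch : ∀ β', 0 ≤ β' → β' < 1 → 0 < wX (sch β'))
    (bXH : ∀ x : MemberY d ℓ hd hL b₀ b₁ Mstar, (bg9YR (Matrix (Fin N) (Fin N) ℂ) (specialUnitaryUnits (Fin N)) R₁ R₂ x).Cfg → BlockNorm (toB6 (geo9Y x) 1 (H x)) (XBK (TrIdx N) x.toKIdx → ℝ))
    (hbXH : ∀ (x : MemberY d ℓ hd hL b₀ b₁ Mstar) (U : (bg9YR (Matrix (Fin N) (Fin N) ℂ) (specialUnitaryUnits (Fin N)) R₁ R₂ x).Cfg), bXH x U =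
      letI : Fintype (geo9K x.toKIdx).Site := (inferInstance : Fintype (geo9Y x).Site);
      bHZKG (κ := TrIdx N) x.toKIdx (trBasis N) (taxiB x.toKIdx (bg9YR (Matrix (Fin N) (Fin N) ℂ) (specialUnitaryUnits (Fin N)) R₁ R₂ x) (fun U => U) U) (R := (1 : ℝ)) (H := H x) le_rfl wX hwX₀ hwX₁)
    (𝔬12 : ∀ x : MemberY d ℓ hd hL b₀ b₁ Mstar, B9Thm312Whole.Ops (geo9Y x) (bg9YR (Matrix (Fin N) (Fin N) ℂ) (specialUnitaryUnits (Fin N)) R₁ R₂ x) (XBK (TrIdx N) x.toKIdx) (XBK (TrIdx N) x.toKIdx) (XHK (TrIdx N) x.toKIdx) (XSK (TrIdx N) x.toKIdx))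
    (hblk12 : ∀ x : MemberY d ℓ hd hL b₀ b₁ Mstar, (𝔬12 x).blk = blkBK x.toKIdx (bI x))
    (hblkW12 : ∀ x : MemberY d ℓ hd hL b₀ b₁ Mstar, (𝔬12 x).blkW = blkSK x.toKIdx (sIK x.toKIdx (bI x)))
    (hDvco12 : ∀ (x : MemberY d ℓ hd hL b₀ b₁ Mstar) (U : (bg9YR (Matrix (Fin N) (Fin N) ℂ) (specialUnitaryUnits (Fin N)) R₁ R₂ x).Cfg), (𝔬12 x).Dv U = DvcoKH x.toKIdx (trBasis N) (bg9YR (Matrix (Fin N) (Fin N) ℂ) (specialUnitaryUnits (Fin N)) R₁ R₂ x) (fun U => U) U)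
    (hDvsco12 : ∀ (x : MemberY d ℓ hd hL b₀ b₁ Mstar) (U : (bg9YR (Matrix (Fin N) (Fin N) ℂ) (specialUnitaryUnits (Fin N)) R₁ R₂ x).Cfg), (𝔬12 x).Dvstar U = DvscoKH x.toKIdx (trBasis N) (bg9YR (Matrix (Fin N) (Fin N) ℂ) (specialUnitaryUnits (Fin N)) R₁ R₂ x) (fun U => U) U)
    (hRco12 : ∀ (x : MemberY d ℓ hd hL b₀ b₁ Mstar) (U : (bg9YR (Matrix (Fin N) (Fin N) ℂ) (specialUnitaryUnits (Fin N)) R₁ R₂ x).Cfg), (𝔬12 x).R U = RcoK x.toKIdx (trBasis N) (bg9YR (Matrix (Fin N) (Fin N) ℂ) (specialUnitaryUnits (Fin N)) R₁ R₂ x) (fun U => U) (parSymY x.toKIdx) (GpPhysY x.toKIdx (parSymY x.toKIdx)) U)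
    (𝔭A : ∀ x : MemberY d ℓ hd hL b₀ b₁ Mstar, HolderProbes (geo9Y x) (bg9YR (Matrix (Fin N) (Fin N) ℂ) (specialUnitaryUnits (Fin N)) R₁ R₂ x) (XBK (TrIdx N) x.toKIdx) (XBK (TrIdx N) x.toKIdx) (PK (FBondY x.toKIdx) (Fin (d + 1)) (TrIdx N)) (PK (FBondY x.toKIdx) (Fin (d + 1)) (TrIdx N)))
    {CP δP : ℝ} (hCP : 0 ≤ CP) (hδP : δFW ≤ δP)
    {parS : ∀ x : MemberY d ℓ hd hL b₀ b₁ Mstar, SiteParY (Matrix (Fin N) (Fin N) ℂ) x.toKIdx} {Gp : ∀ x : MemberY d ℓ hd hL b₀ b₁ Mstar, SiteOpY (Matrix (Fin N) (Fin N) ℂ) x.toKIdx}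
    (hparS : ∀ x : MemberY d ℓ hd hL b₀ b₁ Mstar, parS x = parSymY x.toKIdx) (hGp : ∀ x : MemberY d ℓ hd hL b₀ b₁ Mstar, Gp x = GpY x.toKIdx (parSymY x.toKIdx))
    (h49 : ∀ x : MemberY d ℓ hd hL b₀ b₁ Mstar, M₀ ≤ (geo9Y x).M → ∀ α₀ : ℝ, 0 < α₀ → (geo9Y x).M * α₀ ≤ a₀ → ∀ U : (bg9YR (Matrix (Fin N) (Fin N) ℂ) (specialUnitaryUnits (Fin N)) R₁ R₂ x).Cfg, (bg9YR (Matrix (Fin N) (Fin N) ℂ) (specialUnitaryUnits (Fin N)) R₁ R₂ x).Reg335 c α₀ U →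
      Proj349Maj (g := geo9Y x) (blkSK x.toKIdx (sIK x.toKIdx (bI x))) (blkBK x.toKIdx (bI x))
        (PcoK x.toKIdx (trBasis N) (bg9YR (Matrix (Fin N) (Fin N) ℂ) (specialUnitaryUnits (Fin N)) R₁ R₂ x) (fun U => U) (parS x) (Gp x) U)
        (DvcoKH x.toKIdx (trBasis N) (bg9YR (Matrix (Fin N) (Fin N) ℂ) (specialUnitaryUnits (Fin N)) R₁ R₂ x) (fun U => U) U)
        (DvscoKH x.toKIdx (trBasis N) (bg9YR (Matrix (Fin N) (Fin N) ℂ) (specialUnitaryUnits (Fin N)) R₁ R₂ x) (fun U => U) U) 1 (H x) CP δP)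
    {B45 Bh Bx : ℝ → ℝ} {δ45 δh δ₃ : ℝ} (hB45 : ∀ β', 0 ≤ β' → β' < 1 → 0 ≤ B45 β') (hBh : ∀ β', 0 ≤ β' → β' < 1 → 0 ≤ Bh β')
    (hbud : 0 ≤ δFW - αW * δFW - 2 * σW) (hδ45 : δFW - αW * δFW - 2 * σW ≤ δ45) (hδh : δFW - αW * δFW - σW ≤ δh) (hδ₃ : δ₃ ≤ δFW - αW * δFW - 2 * σW)
    -- the DISPLAYED budget family of the letter (closed in displayed data once `CP` is a displayed letter, `N06Proj349AtPinsPhysRC`)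
    (hBx : ∀ β', 0 ≤ β' → β' < 1 → (cR39 (trBasis N))⁻¹ * ((wX (sch β'))⁻¹ * B45 β' + Bh β' * (CP * (((ℓ + 1 : ℕ) : ℝ))) *
      ((wX (sch β'))⁻¹ * ((((ℓ + 1 : ℕ) : ℝ)) * Real.exp ((δFW - αW * δFW - σW) * (rNear d ℓ + 1)))) * rowConst261 (@geo9Y d ℓ hd hL b₀ b₁ Mstar) σW * rowConst261 (@geo9Y d ℓ hd hL b₀ b₁ Mstar) σW) ≤ Bx β')
    (hp45 : ∀ x : MemberY d ℓ hd hL b₀ b₁ Mstar, letI : Fintype (geo9K x.toKIdx).Site := (inferInstance : Fintype (geo9Y x).Site); M₀ ≤ (geo9Y x).M → ∀ α₀ : ℝ, 0 < α₀ → (geo9Y x).M * α₀ ≤ a₀ → ∀ U : (bg9YR (Matrix (Fin N) (Fin N) ℂ) (specialUnitaryUnits (Fin N)) R₁ R₂ x).Cfg, (bg9YR (Matrix (Fin N) (Fin N) ℂ) (specialUnitaryUnits (Fin N)) R₁ R₂ x).Reg335 c α₀ U →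
      (bg9YR (Matrix (Fin N) (Fin N) ℂ) (specialUnitaryUnits (Fin N)) R₁ R₂ x).Reg336 c α₀ U → ∀ (β' : ℝ) (h0 : 0 ≤ β') (h1 : β' < 1),
        HasMaj (bHZKT (κ := TrIdx N) x.toKIdx (trBasis N) (taxiB x.toKIdx (bg9YR (Matrix (Fin N) (Fin N) ℂ) (specialUnitaryUnits (Fin N)) R₁ R₂ x) (fun U => U) U) (R := (1 : ℝ)) (H := H x) (hsch0 β' h0 h1).le (hsch1 β' h0 h1).le (hsch1 β' h0 h1).le)
          (cNormR 1 (H x) (𝔭A x).blkPX (fun y => (geo9Y_len_pos x y).le) (β' - 1))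
          ((𝔭A x).ΦX U β' ∘ₗ ((𝔬12 x).Dv U ∘ₗ GcoS x.toKIdx (trBasis N) (bg9YR (Matrix (Fin N) (Fin N) ℂ) (specialUnitaryUnits (Fin N)) R₁ R₂ x) (fun U => U) (GpY x.toKIdx (parSymY x.toKIdx)) U ∘ₗ (𝔬12 x).Dvstar U))
          (fun a b => B45 β' * Real.exp (-(δ45 * (geo9Y x).dist a b))))
    (hpDG : ∀ x : MemberY d ℓ hd hL b₀ b₁ Mstar, letI : Fintype (geo9K x.toKIdx).Site := (inferInstance : Fintype (geo9Y x).Site); M₀ ≤ (geo9Y x).M → ∀ α₀ : ℝ, 0 < α₀ → (geo9Y x).M * α₀ ≤ a₀ → ∀ U : (bg9YR (Matrix (Fin N) (Fin N) ℂ) (specialUnitaryUnits (Fin N)) R₁ R₂ x).Cfg, (bg9YR (Matrix (Fin N) (Fin N) ℂ) (specialUnitaryUnits (Fin N)) R₁ R₂ x).Reg335 c α₀ U →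
      (bg9YR (Matrix (Fin N) (Fin N) ℂ) (specialUnitaryUnits (Fin N)) R₁ R₂ x).Reg336 c α₀ U → ∀ (β' : ℝ), 0 ≤ β' → β' < 1 →
        HasMaj (cNormR 1 (H x) (𝔬12 x).blkW (fun y => (geo9Y_len_pos x y).le) 0) (cNormR 1 (H x) (𝔭A x).blkPX (fun y => (geo9Y_len_pos x y).le) (β' - 1))
          ((𝔭A x).ΦX U β' ∘ₗ (𝔬12 x).Dv U ∘ₗ GcoS x.toKIdx (trBasis N) (bg9YR (Matrix (Fin N) (Fin N) ℂ) (specialUnitaryUnits (Fin N)) R₁ R₂ x) (fun U => U) (GpY x.toKIdx (parSymY x.toKIdx)) U)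
          (fun a b => Bh β' * Real.exp (-(δh * (geo9Y x).dist a b)))) :
    ∃ MW : ℝ, ∀ x : MemberY d ℓ hd hL b₀ b₁ Mstar, MW ≤ (geo9Y x).M → ∀ α₀ : ℝ, 0 < α₀ → (geo9Y x).M * α₀ ≤ a₀ →
        ∀ U : (bg9YR (Matrix (Fin N) (Fin N) ℂ) (specialUnitaryUnits (Fin N)) R₁ R₂ x).Cfg, (bg9YR (Matrix (Fin N) (Fin N) ℂ) (specialUnitaryUnits (Fin N)) R₁ R₂ x).Reg335 c α₀ U → (bg9YR (Matrix (Fin N) (Fin N) ℂ) (specialUnitaryUnits (Fin N)) R₁ R₂ x).Reg336 c α₀ U → ∀ β' : ℝ, 0 ≤ β' → β' < 1 →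
          HasMaj (bXH x U) (cNormR 1 (H x) (𝔭A x).blkPX (fun y => (geo9Y_len_pos x y).le) (β' - 1))
            ((𝔭A x).ΦX U β' ∘ₗ ((𝔬12 x).Dv U ∘ₗ GcoS x.toKIdx (trBasis N) (bg9YR (Matrix (Fin N) (Fin N) ℂ) (specialUnitaryUnits (Fin N)) R₁ R₂ x) (fun U => U) (GpY x.toKIdx (parSymY x.toKIdx)) U ∘ₗ (𝔬12 x).R U ∘ₗ (𝔬12 x).Dvstar U))
            (fun a b => Bx β' * Real.exp (-(δ₃ * (geo9Y x).dist a b))) := by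
  obtain ⟨Mg, hFa⟩ := facts347_exp261_geo9Y (d := d) (ℓ := ℓ) (hd := hd) (hL := hL) (b₀ := b₀) (b₁ := b₁) (Mstar := Mstar) H hαW0 hαW1 hδFW
  obtain ⟨ML, hrow⟩ := rowConst261_spec_of_rowSum261 (rowSum261_geo9Y (d := d) (ℓ := ℓ) (hd := hd) (hL := hL) (b₀ := b₀) (b₁ := b₁) (Mstar := Mstar)) hσW
  have hc0 : (0 : ℝ) ≤ rowConst261 (@geo9Y d ℓ hd hL b₀ b₁ Mstar) σW := rowConst261_nonneg _ _
  refine ⟨max M₀ (max Mg ML), ?_⟩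
  · intro x hM α₀ hα ha U hU hU' β' h0 h1
    have hrowx : ∀ x : MemberY d ℓ hd hL b₀ b₁ Mstar, max M₀ (max Mg ML) ≤ (geo9Y x).M → RowSum (toB6 (geo9Y x) 1 (H x)) σW (rowConst261 (@geo9Y d ℓ hd hL b₀ b₁ Mstar) σW) :=
      fun x hM y => hrow x (((le_max_right _ _).trans (le_max_right _ _)).trans hM) y
    exact hWE_of_pins H bI hlev hβ1 hbI0 c (M₀ := max M₀ (max Mg ML)) (a₀ := a₀)
      (fun x hM => hFa x (((le_max_left _ _).trans (le_max_right _ _)).trans hM)) hrowx wX hwX₀ hwX₁ sch hsch0 hsch1 hwsch bXH hbXH 𝔬12 hblk12 hblkW12 hDvco12 hDvsco12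
      hRco12 𝔭A hCP hδP hparS hGp (fun x hM α₀ hα ha U hU => h49 x ((le_max_left _ _).trans hM) α₀ hα ha U hU)
      (δ45 := δ45) (δh := δh) (δ₃ := δ₃) hB45 hBh hc0 hσW.le hbud hδ45 hδh hδ₃ hBx
      (fun x hM α₀ hα ha U hU hU' => hp45 x ((le_max_left _ _).trans hM) α₀ hα ha U hU hU')
      (fun x hM α₀ hα ha U hU hU' => hpDG x ((le_max_left _ _).trans hM) α₀ hα ha U hU hU') x hM α₀ hα ha U hU hU' β' h0 h1

end Summit.QuantumFields.YangMills.BalabanUVNodes.N06WELegAtPinsPhysRUB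

end
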